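import Summits.QuantumFields.GaugeBoot.BootstrapCertificateConeClosed
import Summits.QuantumFields.GaugeBoot.BootstrapFiniteCertificates
import HarnessLib

/-!
# Exact certificates: on a torus the level-`n` certificate cone is closed, so the SDP optimum itself is certified (gauge-boot, L1/L4 supplement)

HONEST FRAMING (cell `pub-gaugeboot`, page 1 of every file): the venture produces certified bounds
on lattice expectations at stated coupling, gauge group, dimension and torus size; NOT a mass gap,
NOT a continuum limit, NOT a string tension; NOT Yang–Mills-summit-bearing (barriers
`FixedCouplingUltralocality`, `PerturbativeInvisibility`). Structural; it certifies no number and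
exhibits no certificate.

## Content

`BootstrapCertificateCompleteness` certifies every constant STRICTLY above the level-`n` SDP
maximum. Here the `ε` is removed on a finite torus: the certificate cone
`certCone = sosCone (wordTruncation n) + rowSpace` is CLOSED in `C(configurations, ℝ)`.

* (`BootstrapCertificateConeClosed.lean`) ★ `isClosed_sosCone_add_of_faithful`: `SOS(span m) + L` is
  closed for `m` linearly independent, `L` finite-dimensional, given a faithful bounded functional
  vanishing on `L`.
* ★★ `isClosed_certConeSuN` — `SU(N)` on `(ℤ/L)^d`, every `β`, every level `n`: the Wilson functional
  is such a `φ` (it is feasible and the Wilson measure charges every open set,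
  `isOpenPosMeasure_wilsonMeasure`), the words of length `≤ n` span a finite-dimensional space with a
  basis, and the row space sits in the span of the words of length `≤ n + 4`.
* ★★★ `sSup_smul_one_sub_mem_certCone_suN` / `forall_levelValues_le_iff_mem_certCone_suN` — DUAL
  ATTAINMENT: for `P` in the certificate domain, `(max levelValuesSuN N β n P) • 1 - P ∈ certConeSuN N β n`;
  `φ P ≤ c` for all level-`n` feasible `φ` iff `c • 1 - P ∈ certConeSuN N β n` — with NO `ε`.

References: Rockafellar, Convex Analysis, Cor. 9.1.3 (closedness of a sum of cones without opposite
directions); Blekherman–Parrilo–Thomas (2012) §3 (closedness of SOS cones); Josz–Henrion (2016).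
Folklore.
-/

noncomputable section

open MeasureTheory Filter Topology NormedSpace Matrix
open scoped MatrixOrder Matrix.Norms.Elementwise
open Literature.MathematicalPhysics.QuantumFieldTheory (LatticeRep Edge GaugeConfig wilsonAction
  wilsonWeight partitionFunction wilsonMeasure isProbabilityMeasure_wilsonMeasure haarProbability)
open Literature.MathematicalPhysics.QuantumLattice

namespace Summit.QuantumFields.GaugeBoot

open OrderUnitDuality

/-! ## `SU(N)` on the torus: the certificate cone is closed; exact certificates -/

section SuN

variable {d L : ℕ} [NeZero L] (N : ℕ) (β : ℝ)

/-- **Level-`n` row elements are test functions of word length `≤ n + 4`** (the derivative of a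
word of length `≤ n` has length `≤ n`; the action derivatives have length `4`). -/
theorem rowSet_subset_wordTruncation_suN (n : ℕ) :
    rowSet (fundamentalLatticeRep N) (suExp N) (fun _ => wilsonAction (fundamentalRep (Fin N))) β
        (wordTruncation (ι := Edge d L) (fundamentalLatticeRep N) n) ⊆
      wordTruncation (ι := Edge d L) (fundamentalLatticeRep N) (n + 4) := by
  rintro x ⟨i, a, f, f', S', hf, -, -, hS'd, hf'd, rfl⟩
  -- `f'` is THE shift derivative of `f`, a word observable of length `≤ n`
  have hfd : HasShiftDeriv (suExp N) i a f (sderiv (suExp N) i a f) :=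
    hasShiftDeriv_sderiv_of_mem_polyAlgebra (suExp_add N)
      (X := fun X : SuGenerator N => (X : Matrix (Fin N) (Fin N) ℂ)) (rho_suExp N) i a
      (wordTruncation_subset_polyAlgebra _ n hf)
  have he : f' = sderiv (suExp N) i a f := HasShiftDeriv.unique hf'd hfd
  have hf'n : f' ∈ wordTruncation (ι := Edge d L) (fundamentalLatticeRep N) n := by
    rw [he]
    exact mem_wordTruncation_of_mem_wordSpace _ (sderiv_mem_wordSpace (suExp_add N)
      (X := fun X : SuGenerator N => (X : Matrix (Fin N) (Fin N) ℂ)) (rho_suExp N) i a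
      (mem_wordSpace_univ_of_mem_wordTruncation _ hf))
  -- `S'` is the degree-`4` action derivative
  have hSd : HasShiftDeriv (suExp N) i a (wilsonActionCM (d := d) (L := L) (fundamentalLatticeRep N))
      (torusActionDeriv (fundamentalLatticeRep N) (suExp N) i a) := fun U =>
    hasDerivAt_torusActionDeriv (fundamentalLatticeRep N) (suExp_add N)
      (X := fun X : SuGenerator N => (X : Matrix (Fin N) (Fin N) ℂ)) (rho_suExp N) i a U
  have hSd' : HasShiftDeriv (suExp N) i a (wilsonActionCM (d := d) (L := L) (fundamentalLatticeRep N)) S' :=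
    fun U => hS'd U
  have heS : S' = torusActionDeriv (fundamentalLatticeRep N) (suExp N) i a := HasShiftDeriv.unique hSd' hSd
  have hS4 : S' ∈ wordTruncation (ι := Edge d L) (fundamentalLatticeRep N) 4 := by
    rw [heS]
    exact mem_wordTruncation_of_mem_wordSpace _ (torusActionDeriv_mem (fundamentalLatticeRep N)
      (suExp_add N) (X := fun X : SuGenerator N => (X : Matrix (Fin N) (Fin N) ℂ)) (rho_suExp N) i a)
  change f' - β • (f * S') ∈ Submodule.span ℝ (wordsUpTo (ι := Edge d L) (fundamentalLatticeRep N) (n + 4))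
  exact Submodule.sub_mem _ (wordTruncation_mono _ (Nat.le_add_right n 4) hf'n)
    (Submodule.smul_mem _ _ (mul_mem_wordTruncation_add _ hf hS4))

/-- ★★ **The level-`n` certificate cone of the `SU(N)` torus bootstrap is closed.** [folklore] -/
theorem isClosed_certConeSuN (n : ℕ) :
    IsClosed (certConeSuN (d := d) (L := L) N β n :
      Set C(GaugeConfig d L (Matrix.specialUnitaryGroup (Fin N) ℂ), ℝ)) := by
  classical
  haveI hP : IsProbabilityMeasure (wilsonMeasure (d := d) (L := L) (fundamentalRep (Fin N)) β) :=
    isProbabilityMeasure_wilsonMeasure (ρ := fundamentalRep (Fin N)) (continuous_fundamentalRep _) β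
  -- a basis of the level-`n` test space
  set W : Submodule ℝ C(GaugeConfig d L (Matrix.specialUnitaryGroup (Fin N) ℂ), ℝ) :=
    Submodule.span ℝ (wordsUpTo (ι := Edge d L) (fundamentalLatticeRep N) n) with hW
  haveI : FiniteDimensional ℝ W :=
    FiniteDimensional.span_of_finite ℝ (wordsUpTo_finite (fundamentalLatticeRep N) n)
  let b := Module.finBasis ℝ W
  let m : Fin (Module.finrank ℝ W) → C(GaugeConfig d L (Matrix.specialUnitaryGroup (Fin N) ℂ), ℝ) :=
    fun i => (b i : C(GaugeConfig d L (Matrix.specialUnitaryGroup (Fin N) ℂ), ℝ))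
  have hm : LinearIndependent ℝ m := b.linearIndependent.map' W.subtype W.ker_subtype
  have hspan : Submodule.span ℝ (Set.range m) = W := by
    show Submodule.span ℝ (Set.range (W.subtype ∘ b)) = W
    rw [Set.range_comp, ← Submodule.map_span, b.span_eq, Submodule.map_top, Submodule.range_subtype]
  -- the row space is finite-dimensional
  set Lr := rowSpace (fundamentalLatticeRep N) (suExp N) (fun _ => wilsonAction (fundamentalRep (Fin N)))
    β (wordTruncation (ι := Edge d L) (fundamentalLatticeRep N) n) with hLr
  haveI : FiniteDimensional ℝ
      (Submodule.span ℝ (wordsUpTo (ι := Edge d L) (fundamentalLatticeRep N) (n + 4))) :=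
    FiniteDimensional.span_of_finite ℝ (wordsUpTo_finite (fundamentalLatticeRep N) (n + 4))
  haveI : FiniteDimensional ℝ Lr :=
    Submodule.finiteDimensional_of_le (Submodule.span_le.2 (rowSet_subset_wordTruncation_suN N β n))
  -- the Wilson functional: feasible (vanishes on rows), bounded, faithful
  set φ := expectationFunctional (wilsonMeasure (d := d) (L := L) (fundamentalRep (Fin N)) β) with hφ
  have hfeas := isBootstrapFeasible_wilson_suN (d := d) (L := L) N β _ rfl
    (wordTruncation_subset_polyAlgebra (fundamentalLatticeRep N) n)
  have hφL : ∀ x ∈ Lr, φ x = 0 := fun x hx => hfeas.apply_eq_zero_of_mem_rowSpace _ hx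
  have hφC : ∀ f, φ f ≤ 1 * ‖f‖ := expectationFunctional_le_norm _
  haveI : IsProbabilityMeasure (wilsonMeasure (d := d) (L := L) (fundamentalLatticeRep N).ρ β) := hP
  have hφpos : ∀ v ∈ Submodule.span ℝ (Set.range m), v ≠ 0 → 0 < φ (v * v) := by
    intro v _ hv
    refine lt_of_le_of_ne (expectationFunctional_sq_nonneg _ v) fun h => hv ?_
    exact eq_zero_of_wilson_integral_mul_self_eq_zero (fundamentalLatticeRep N) β v h.symm
  have hclosed := isClosed_sosCone_add_of_faithful m hm Lr φ hφL zero_le_one hφC hφpos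
  have hset : (wordTruncation (ι := Edge d L) (fundamentalLatticeRep N) n) =
      (Submodule.span ℝ (Set.range m) : Set _) := by
    rw [hspan]; rfl
  have hsos : sosCone (wordTruncation (ι := Edge d L) (fundamentalLatticeRep N) n) =
      sosCone (Submodule.span ℝ (Set.range m) : Set _) := by rw [hset]
  convert hclosed using 1
  ext x
  rw [SetLike.mem_coe, mem_certCone_iff, hsos]
  rfl

/-- ★★★ **Exact duality for the `SU(N)` torus bootstrap** (no `ε`): for `P` in the level-`n`
certificate domain, every level-`n` feasible value of `P` is `≤ c` if and only if `c • 1 - P` has a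
level-`n` SOS ⊕ loop-equation certificate. [folklore] -/
theorem forall_levelValues_le_iff_mem_certCone_suN {n : ℕ}
    {P : C(GaugeConfig d L (Matrix.specialUnitaryGroup (Fin N) ℂ), ℝ)}
    (hP : P ∈ certDomainSuN (d := d) (L := L) N β n) {c : ℝ} :
    (∀ t ∈ levelValuesSuN (d := d) (L := L) N β n P, t ≤ c) ↔
      c • (1 : C(GaugeConfig d L (Matrix.specialUnitaryGroup (Fin N) ℂ), ℝ)) - P ∈
        certConeSuN (d := d) (L := L) N β n := by
  refine ⟨fun h => ?_, fun hc => levelValues_le_of_mem_certCone_suN N β hc⟩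
  have hcl : IsClosed {t : ℝ | t • (1 : C(GaugeConfig d L (Matrix.specialUnitaryGroup (Fin N) ℂ), ℝ))
      - P ∈ certConeSuN (d := d) (L := L) N β n} :=
    (isClosed_certConeSuN N β n).preimage ((continuous_id.smul continuous_const).sub continuous_const)
  have hIoi : Set.Ioi c ⊆ {t : ℝ | t • (1 : C(GaugeConfig d L (Matrix.specialUnitaryGroup (Fin N) ℂ), ℝ))
      - P ∈ certConeSuN (d := d) (L := L) N β n} := by
    intro t ht
    obtain ⟨σ, hσ, ρ, hρ, hcert⟩ := exists_certificate_suN N β hP h ht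
    rw [Set.mem_setOf_eq, ← hcert]
    exact (mem_certCone_iff _).2 ⟨σ, hσ, ρ, hρ, rfl⟩
  have hmem : c ∈ closure (Set.Ioi c) := by rw [closure_Ioi]; exact Set.self_mem_Ici
  exact hcl.closure_subset_iff.2 hIoi hmem

/-- ★★★ **Dual attainment: the SDP optimum itself is certified.** For `P` in the level-`n`
certificate domain, `(max levelValuesSuN N β n P) • 1 - P ∈ certConeSuN N β n`. [folklore] -/
theorem sSup_smul_one_sub_mem_certCone_suN {n : ℕ}
    {P : C(GaugeConfig d L (Matrix.specialUnitaryGroup (Fin N) ℂ), ℝ)}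
    (hP : P ∈ certDomainSuN (d := d) (L := L) N β n) :
    sSup (levelValuesSuN (d := d) (L := L) N β n P) •
        (1 : C(GaugeConfig d L (Matrix.specialUnitaryGroup (Fin N) ℂ), ℝ)) - P ∈
      certConeSuN (d := d) (L := L) N β n := by
  obtain ⟨lo, hi, hIcc, hW⟩ := levelValues_eq_Icc_suN N β hP
  refine (forall_levelValues_le_iff_mem_certCone_suN N β hP).1 fun t ht => ?_
  rw [hIcc] at ht ⊢
  rw [csSup_Icc (hW.1.trans hW.2)]
  exact ht.2

/-- ★★★ **The optimum certificate in `certsdp` format**: a PSD matrix on an enumeration of the words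
of length `≤ n` and a row combination certify EXACTLY the level-`n` SDP upper bound. [folklore] -/
theorem exists_gram_certificate_sSup_suN {n : ℕ}
    {P : C(GaugeConfig d L (Matrix.specialUnitaryGroup (Fin N) ℂ), ℝ)}
    (hP : P ∈ certDomainSuN (d := d) (L := L) N β n) :
    ∃ (s : ℕ) (m : Fin s → C(GaugeConfig d L (Matrix.specialUnitaryGroup (Fin N) ℂ), ℝ)),
      Set.range m = wordsUpTo (ι := Edge d L) (fundamentalLatticeRep N) n ∧
      ∃ Q : Matrix (Fin s) (Fin s) ℝ, Q.PosSemidef ∧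
        ∃ ρ ∈ rowSpace (fundamentalLatticeRep N) (suExp N) (fun _ => wilsonAction (fundamentalRep (Fin N)))
          β (wordTruncation (ι := Edge d L) (fundamentalLatticeRep N) n),
          gramForm m Q + ρ = sSup (levelValuesSuN (d := d) (L := L) N β n P) •
            (1 : C(GaugeConfig d L (Matrix.specialUnitaryGroup (Fin N) ℂ), ℝ)) - P := by
  classical
  obtain ⟨s, m, hm⟩ := exists_fin_range_eq_wordsUpTo (fundamentalLatticeRep N) (ι := Edge d L) n
  obtain ⟨σ, hσ, ρ, hρ, hcert⟩ := (mem_certCone_iff _).1 (sSup_smul_one_sub_mem_certCone_suN N β hP)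
  rw [← span_range_eq_wordTruncation (fundamentalLatticeRep N) hm] at hσ
  obtain ⟨Q, hQ, rfl⟩ := exists_posSemidef_of_mem_sosCone m hσ
  exact ⟨s, m, hm, Q, hQ, ρ, hρ, hcert⟩

/-- ★★ **The level-`n` certified upper bounds of `P` are exactly `[max levelValuesSuN, ∞)`.**
[folklore] -/
theorem setOf_certified_eq_Ici_suN {n : ℕ}
    {P : C(GaugeConfig d L (Matrix.specialUnitaryGroup (Fin N) ℂ), ℝ)}
    (hP : P ∈ certDomainSuN (d := d) (L := L) N β n) :
    {c : ℝ | c • (1 : C(GaugeConfig d L (Matrix.specialUnitaryGroup (Fin N) ℂ), ℝ)) - P ∈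
        certConeSuN (d := d) (L := L) N β n} =
      Set.Ici (sSup (levelValuesSuN (d := d) (L := L) N β n P)) := by
  obtain ⟨lo, hi, hIcc, hW⟩ := levelValues_eq_Icc_suN N β hP
  have hsup : sSup (levelValuesSuN (d := d) (L := L) N β n P) = hi := by
    rw [hIcc]; exact csSup_Icc (hW.1.trans hW.2)
  ext c
  rw [Set.mem_setOf_eq, ← forall_levelValues_le_iff_mem_certCone_suN N β hP, Set.mem_Ici, hsup, hIcc]
  exact ⟨fun h => h hi (Set.right_mem_Icc.2 (hW.1.trans hW.2)), fun h t ht => ht.2.trans h⟩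

end SuN

end Summit.QuantumFields.GaugeBoot

end
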